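import Literature.Topology.FourManifolds.SliceDiscExteriorMeridian
import Literature.Topology.FourManifolds.DehnSurgeryFundamentalGroup
import Literature.AlgebraicTopology.SingularHomology.HurewiczOne
import Summits.SmoothPoincare4.SmoothPoincare4.Theses.DottedCircleRasmussen

/-!
# Helper `helper_friendsCarrier_Vk_partA_tubeLoops` (piece 9 of the registered stub
`helper_friendsCarrier_Vk_partA`, line `mk_friends`, skeleton v8) for crux `DcrGap`
(item stmt-SmoothPoincare4-16128, route route-SmoothPoincare4-DottedCircleRasmussen)

**Loops in a punctured tube are powers of the meridian; a loop of meridian exponent zero has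
null-homotopic fibre coordinates.**  The push-off input of Part A (the one remaining debt of V_k part A,
`work/stubs/VkPartA_rest.lean` of the line) asks for the null-homotopy, in `ℝ² ∖ 0`, of the fibre
coordinates of a push-off of the model knot read in the affine tube `F` of the enlarged slice disc.  This
file provides the local half of the homological argument, for an arbitrary continuous tube
`F : B(0,R) × B(0,η) → ℝ⁴` with continuous left inverse `Finv` on its image: if a loop `γ` of a subspace
`Z ⊇ F(B(0,R) × (B(0,η) ∖ 0))` runs in the punctured tube, then for some `n : ℤ`

* its Hurewicz class is `n` times that of the meridian `t ↦ F(x₀, e^{2πit} · w₀)` through its base point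
  `F(x₀, w₀)` (as loops of `Z`), and
* if `n = 0`, its fibre-coordinate loop `t ↦ (Finv (γ t)).2` is null-homotopic in `ℝ² ∖ 0` as a based loop.

Proof: the pattern of the tree's `ConicalDiscTube.fromPath_mem_zpowers_meridianU`
(`SliceDiscExteriorMeridian.lean`): the punctured tube is parametrised by `B(0,R) × (ℂ ∖ 0)` (radial
squeeze `ConicalDiscTube.kap` of the punctured plane onto the punctured fibre disc, rotated so that the
positive axis passes through `w₀`), where every loop is a power of the slice winding loop
(`PuncturedPlane.fromPath_mem_zpowers_slice`, the covering `exp`, the ball being simply connected); the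
Hurewicz homomorphism (`…HurewiczOne`) turns the relation in `π₁` into the relation of classes, and for
exponent `0` the loop in `B(0,R) × (ℂ ∖ 0)` is null-homotopic, whence its fibre coordinate.

* `helper_friendsCarrier_Vk_partA_tubeLoops` — the registered statement.

No definitions, no named facts, no `sorry`.

## References

* A. Hatcher, *Algebraic Topology*, CUP (2002), Thm. 1.7, Prop. 1.12, Thm. 2A.1. [HatcherAT2002]
-/

-- the prescribed namespace `Summit.<P>.<Sub>.…` duplicates `SmoothPoincare4` (P = Sub)
set_option linter.dupNamespace false
set_option linter.style.longLine false

noncomputable section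

open scoped Topology
open Set Function Metric Filter unitInterval Complex
open Literature.Topology.FourManifolds Literature.Topology.FourManifolds.PlaneComplex
  Literature.AlgebraicTopology.FundamentalGroup.PuncturedPlane Literature.AlgebraicTopology.SingularHomology

namespace Summit.SmoothPoincare4.SmoothPoincare4.Theorems.DcrGap.MkFriends

namespace FriendsCarrierVk

/-! ## Plane and complex numbers -/

/-- `toC` is real-linear in the scalar. [folklore] -/
theorem toC_smul (a : ℝ) (v : EuclideanSpace ℝ (Fin 2)) : toC (a • v) = (a : ℂ) * toC v := by
  apply Complex.ext <;> simp [toC]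

/-- `ofC` is real-linear in the scalar. [folklore] -/
theorem ofC_smul (a : ℝ) (z : ℂ) : ofC ((a : ℂ) * z) = a • ofC z := by
  ext i; fin_cases i <;> simp

/-- The squeeze commutes with the identification `ℂ ≅ ℝ²` up to unit factors: `kap (ofC (e z)) = ofC (e · toC (kap (ofC z)))`
for `|e| = 1`. [folklore] -/
theorem kap_ofC_mul {e : ℂ} (he : ‖e‖ = 1) (z : ℂ) :
    ConicalDiscTube.kap (ofC (e * z)) = ofC (e * toC (ConicalDiscTube.kap (ofC z))) := by
  have h1 : ‖ofC (e * z)‖ = ‖z‖ := by rw [Knot.TubularNbhd.norm_ofC, norm_mul, he, one_mul]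
  calc ConicalDiscTube.kap (ofC (e * z)) = (2 / (1 + ‖z‖)) • ofC (e * z) := by rw [ConicalDiscTube.kap, h1]
    _ = ofC (((2 / (1 + ‖z‖) : ℝ) : ℂ) * (e * z)) := (ofC_smul _ _).symm
    _ = ofC (e * (((2 / (1 + ‖z‖) : ℝ) : ℂ) * z)) := by ring_nf
    _ = ofC (e * toC (ConicalDiscTube.kap (ofC z))) := by rw [ConicalDiscTube.kap, toC_smul, toC_ofC, Knot.TubularNbhd.norm_ofC]

/-! ## Loops in the punctured tube -/

/-- **Loops in a punctured tube are powers of the meridian; exponent zero has null-homotopic fibre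
coordinates.** [cite: HatcherAT2002, Thm. 1.7] -/
theorem exists_meridian_exponent (F : EuclideanSpace ℝ (Fin 2) × EuclideanSpace ℝ (Fin 2) → EuclideanSpace ℝ (Fin 4))
    (Finv : EuclideanSpace ℝ (Fin 4) → EuclideanSpace ℝ (Fin 2) × EuclideanSpace ℝ (Fin 2)) (R η : ℝ) (hη : 0 < η)
    (hFc : ContinuousOn F (ball (0 : EuclideanSpace ℝ (Fin 2)) R ×ˢ ball (0 : EuclideanSpace ℝ (Fin 2)) η))
    (hFinvc : ContinuousOn Finv (F '' (ball (0 : EuclideanSpace ℝ (Fin 2)) R ×ˢ ball (0 : EuclideanSpace ℝ (Fin 2)) η)))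
    (hleft : ∀ q ∈ ball (0 : EuclideanSpace ℝ (Fin 2)) R ×ˢ ball (0 : EuclideanSpace ℝ (Fin 2)) η, Finv (F q) = q)
    (Z : Set (EuclideanSpace ℝ (Fin 4)))
    (hZ : F '' (ball (0 : EuclideanSpace ℝ (Fin 2)) R ×ˢ (ball (0 : EuclideanSpace ℝ (Fin 2)) η ∩ {w | w ≠ 0})) ⊆ Z)
    {p : ↥Z} (γ : Path p p)
    (hγ : ∀ t, ((γ t : ↥Z) : EuclideanSpace ℝ (Fin 4)) ∈ F '' (ball (0 : EuclideanSpace ℝ (Fin 2)) R ×ˢ (ball (0 : EuclideanSpace ℝ (Fin 2)) η ∩ {w | w ≠ 0}))) :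
    ∃ n : ℤ, (∀ μ : Path p p, (∀ t, ((μ t : ↥Z) : EuclideanSpace ℝ (Fin 4)) =
        F ((Finv (p : EuclideanSpace ℝ (Fin 4))).1, ofC (Complex.exp (((2 * Real.pi * t : ℝ) : ℂ) * Complex.I) * toC (Finv (p : EuclideanSpace ℝ (Fin 4))).2))) →
        loopClass ℤ ℤ (1 : ℤ) γ = n • loopClass ℤ ℤ (1 : ℤ) μ) ∧
      (n = 0 → ∃ h : I × I → EuclideanSpace ℝ (Fin 2), Continuous h ∧ (∀ q, h q ≠ 0) ∧
        (∀ t, h (0, t) = (Finv ((γ t : ↥Z) : EuclideanSpace ℝ (Fin 4))).2) ∧ (∀ t, h (1, t) = (Finv (p : EuclideanSpace ℝ (Fin 4))).2) ∧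
        ∀ s, h (s, 0) = (Finv (p : EuclideanSpace ℝ (Fin 4))).2 ∧ h (s, 1) = (Finv (p : EuclideanSpace ℝ (Fin 4))).2) := by
  haveI : SimplyConnectedSpace ↥(ball (0 : EuclideanSpace ℝ (Fin 2)) R) := by
    have hR : 0 < R := by
      obtain ⟨q, ⟨hq, -⟩, -⟩ := hγ 0
      exact lt_of_le_of_lt (norm_nonneg _) (mem_ball_zero_iff.1 hq)
    haveI := (convex_ball (0 : EuclideanSpace ℝ (Fin 2)) R).contractibleSpace ⟨0, by simpa using hR⟩
    infer_instance
  set dom : Set (EuclideanSpace ℝ (Fin 2) × EuclideanSpace ℝ (Fin 2)) :=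
    ball (0 : EuclideanSpace ℝ (Fin 2)) R ×ˢ ball (0 : EuclideanSpace ℝ (Fin 2)) η with hdom
  set pdom : Set (EuclideanSpace ℝ (Fin 2) × EuclideanSpace ℝ (Fin 2)) :=
    ball (0 : EuclideanSpace ℝ (Fin 2)) R ×ˢ (ball (0 : EuclideanSpace ℝ (Fin 2)) η ∩ {w | w ≠ 0}) with hpdom
  have hpd : pdom ⊆ dom := prod_mono Subset.rfl inter_subset_left
  have hright : ∀ y ∈ F '' dom, F (Finv y) = y := by
    rintro _ ⟨q, hq, rfl⟩; rw [hleft q hq]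
  have hFinv_mem : ∀ y ∈ F '' pdom, Finv y ∈ pdom := by
    rintro _ ⟨q, hq, rfl⟩; rwa [hleft q (hpd hq)]
  -- the base point in tube coordinates
  set x₀ : EuclideanSpace ℝ (Fin 2) := (Finv (p : EuclideanSpace ℝ (Fin 4))).1 with hx₀
  set w₀ : EuclideanSpace ℝ (Fin 2) := (Finv (p : EuclideanSpace ℝ (Fin 4))).2 with hw₀
  have hp_mem : (p : EuclideanSpace ℝ (Fin 4)) ∈ F '' pdom := by rw [← γ.source]; exact hγ 0
  have hq₀ : Finv (p : EuclideanSpace ℝ (Fin 4)) ∈ pdom := hFinv_mem _ hp_mem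
  have hx₀R : ‖x₀‖ < R := mem_ball_zero_iff.1 hq₀.1
  have hw₀η : ‖w₀‖ < η := mem_ball_zero_iff.1 hq₀.2.1
  have hw₀0 : w₀ ≠ 0 := hq₀.2.2
  have hFp : F (x₀, w₀) = p := by rw [hx₀, hw₀, Prod.mk.eta]; exact hright _ (image_mono hpd hp_mem)
  -- the fibre identification `ζ ↦ (η/2) kap (ofC (ζ u₀))`
  set sc : ℝ := η / 2 with hsc
  have hscpos : 0 < sc := by rw [hsc]; linarith
  have hsc2 : sc * 2 = η := by rw [hsc]; ring
  set v₀ : EuclideanSpace ℝ (Fin 2) := ConicalDiscTube.kapInv (sc⁻¹ • w₀) with hv₀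
  have hsw : ∀ w : EuclideanSpace ℝ (Fin 2), ‖w‖ < η → ‖sc⁻¹ • w‖ < 2 := fun w hw => by
    rw [norm_smul, norm_inv, Real.norm_of_nonneg hscpos.le, inv_mul_lt_iff₀ hscpos, hsc2]; exact hw
  have hv₀0 : v₀ ≠ 0 := ConicalDiscTube.kapInv_ne_zero (hsw w₀ hw₀η) (smul_ne_zero (inv_ne_zero hscpos.ne') hw₀0)
  set c₀ : ℂ := toC v₀ with hc₀
  have hc₀0 : c₀ ≠ 0 := toC_ne_zero hv₀0
  set r₀ : ℝ := ‖c₀‖ with hr₀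
  have hr₀pos : 0 < r₀ := norm_pos_iff.2 hc₀0
  set u₀ : ℂ := c₀ / r₀ with hu₀
  have hu₀n : ‖u₀‖ = 1 := by rw [hu₀, norm_div, Complex.norm_real, Real.norm_of_nonneg hr₀pos.le, div_self hr₀pos.ne']
  have hu₀0 : u₀ ≠ 0 := fun h => by rw [h, norm_zero] at hu₀n; exact zero_ne_one hu₀n
  have hr₀C : (r₀ : ℂ) ≠ 0 := by exact_mod_cast hr₀pos.ne'
  have hru : (r₀ : ℂ) * u₀ = c₀ := by rw [hu₀, mul_comm, div_mul_cancel₀ _ hr₀C]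
  -- fibre maps
  have hψmem : ∀ ζ : CStar, sc • ConicalDiscTube.kap (ofC ((ζ : ℂ) * u₀)) ∈ ball (0 : EuclideanSpace ℝ (Fin 2)) η ∩ {w | w ≠ 0} := fun ζ => by
    refine ⟨mem_ball_zero_iff.2 ?_, smul_ne_zero hscpos.ne' (ConicalDiscTube.kap_ne_zero (ofC_ne_zero (mul_ne_zero ζ.2 hu₀0)))⟩
    rw [norm_smul, Real.norm_of_nonneg hscpos.le, ← hsc2]
    exact mul_lt_mul_of_pos_left (ConicalDiscTube.norm_kap_lt _) hscpos
  have hψv₀ : sc • ConicalDiscTube.kap (ofC ((r₀ : ℂ) * u₀)) = w₀ := by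
    rw [hru, hc₀, ofC_toC, hv₀, ConicalDiscTube.kap_kapInv (hsw w₀ hw₀η), smul_smul, mul_inv_cancel₀ hscpos.ne', one_smul]
  -- the tube map `Φ : B(0,R) × (ℂ ∖ 0) → Z`
  let Φ : C(↥(ball (0 : EuclideanSpace ℝ (Fin 2)) R) × CStar, ↥Z) :=
    ⟨fun a => ⟨F ((a.1 : EuclideanSpace ℝ (Fin 2)), sc • ConicalDiscTube.kap (ofC ((a.2 : ℂ) * u₀))),
        hZ ⟨((a.1 : EuclideanSpace ℝ (Fin 2)), sc • ConicalDiscTube.kap (ofC ((a.2 : ℂ) * u₀))),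
          mk_mem_prod a.1.2 (hψmem a.2), rfl⟩⟩, by
      refine Continuous.subtype_mk ?_ _
      have h2 : Continuous fun a : ↥(ball (0 : EuclideanSpace ℝ (Fin 2)) R) × CStar => (a.2 : ℂ) * u₀ :=
        (continuous_subtype_val.comp continuous_snd).mul continuous_const
      have h3 : Continuous fun a : ↥(ball (0 : EuclideanSpace ℝ (Fin 2)) R) × CStar =>
          sc • ConicalDiscTube.kap (ofC ((a.2 : ℂ) * u₀)) :=
        (ConicalDiscTube.continuous_kap.comp (continuous_ofC.comp h2)).const_smul sc
      have h4 : Continuous fun a : ↥(ball (0 : EuclideanSpace ℝ (Fin 2)) R) × CStar =>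
          (((a.1 : EuclideanSpace ℝ (Fin 2)), sc • ConicalDiscTube.kap (ofC ((a.2 : ℂ) * u₀))) : EuclideanSpace ℝ (Fin 2) × EuclideanSpace ℝ (Fin 2)) :=
        (continuous_subtype_val.comp continuous_fst).prodMk h3
      exact hFc.comp_continuous h4 fun a => mk_mem_prod a.1.2 (hψmem a.2).1⟩
  have hΦval : ∀ a, ((Φ a : ↥Z) : EuclideanSpace ℝ (Fin 4)) = F ((a.1 : EuclideanSpace ℝ (Fin 2)), sc • ConicalDiscTube.kap (ofC ((a.2 : ℂ) * u₀))) :=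
    fun a => rfl
  let b : ↥(ball (0 : EuclideanSpace ℝ (Fin 2)) R) × CStar := (⟨x₀, mem_ball_zero_iff.2 hx₀R⟩, bpt r₀ hr₀pos)
  have hb : Φ b = p := Subtype.ext (by rw [hΦval]; exact (congrArg (fun w => F (x₀, w)) (by exact hψv₀)).trans hFp)
  -- the loop in tube coordinates
  let z : I → EuclideanSpace ℝ (Fin 4) := fun t => ((γ t : ↥Z) : EuclideanSpace ℝ (Fin 4))
  have hz : Continuous z := continuous_subtype_val.comp γ.continuous
  let q : I → EuclideanSpace ℝ (Fin 2) × EuclideanSpace ℝ (Fin 2) := fun t => Finv (z t)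
  have hq : Continuous q := hFinvc.comp_continuous hz fun t => image_mono hpd (hγ t)
  have hqp : ∀ t, q t ∈ pdom := fun t => hFinv_mem _ (hγ t)
  have hFq : ∀ t, F (q t) = z t := fun t => hright _ (image_mono hpd (hγ t))
  have hq0 : q 0 = (x₀, w₀) := by
    change Finv (((γ 0 : ↥Z) : EuclideanSpace ℝ (Fin 4))) = _
    rw [γ.source]
  have hq1 : q 1 = (x₀, w₀) := by
    change Finv (((γ 1 : ↥Z) : EuclideanSpace ℝ (Fin 4))) = _
    rw [γ.target]
  -- the fibre coordinate as a non-zero complex number, rotated back by `u₀`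
  have hfib : ∀ t, toC (ConicalDiscTube.kapInv (sc⁻¹ • (q t).2)) / u₀ ≠ 0 := fun t =>
    div_ne_zero (toC_ne_zero (ConicalDiscTube.kapInv_ne_zero (hsw (q t).2 (mem_ball_zero_iff.1 (hqp t).2.1))
      (smul_ne_zero (inv_ne_zero hscpos.ne') (hqp t).2.2))) hu₀0
  have hfib0 : toC (ConicalDiscTube.kapInv (sc⁻¹ • w₀)) / u₀ = r₀ := by
    rw [← hv₀, ← hc₀, ← hru, mul_div_assoc, div_self hu₀0, mul_one]
  let β : Path b b :=
    { toFun := fun t => (⟨(q t).1, (hqp t).1⟩, ⟨toC (ConicalDiscTube.kapInv (sc⁻¹ • (q t).2)) / u₀, hfib t⟩)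
      continuous_toFun := by
        refine ((continuous_fst.comp hq).subtype_mk _).prodMk (Continuous.subtype_mk ?_ _)
        have hk : Continuous fun t : I => ConicalDiscTube.kapInv (sc⁻¹ • (q t).2) :=
          ConicalDiscTube.continuousOn_kapInv.comp_continuous ((continuous_snd.comp hq).const_smul sc⁻¹)
            fun t => mem_ball_zero_iff.2 (hsw (q t).2 (mem_ball_zero_iff.1 (hqp t).2.1))
        exact (continuous_toC.comp hk).div_const u₀
      source' := by
        refine Prod.ext (Subtype.ext ?_) (Subtype.ext ?_)
        · change (q 0).1 = x₀; rw [hq0]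
        · change toC (ConicalDiscTube.kapInv (sc⁻¹ • (q 0).2)) / u₀ = (r₀ : ℂ); rw [hq0]; exact hfib0
      target' := by
        refine Prod.ext (Subtype.ext ?_) (Subtype.ext ?_)
        · change (q 1).1 = x₀; rw [hq1]
        · change toC (ConicalDiscTube.kapInv (sc⁻¹ • (q 1).2)) / u₀ = (r₀ : ℂ); rw [hq1]; exact hfib0 }
  have hβ2 : ∀ t, ((β t).2 : ℂ) = toC (ConicalDiscTube.kapInv (sc⁻¹ • (q t).2)) / u₀ := fun t => rfl
  have hfibre_back : ∀ t, sc • ConicalDiscTube.kap (ofC (((β t).2 : ℂ) * u₀)) = (q t).2 := fun t => by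
    rw [hβ2, div_mul_cancel₀ _ hu₀0, ofC_toC, ConicalDiscTube.kap_kapInv (hsw (q t).2 (mem_ball_zero_iff.1 (hqp t).2.1)),
      smul_smul, mul_inv_cancel₀ hscpos.ne', one_smul]
  have hγβ : ∀ t, γ t = Φ (β t) := fun t => by
    apply Subtype.ext
    rw [hΦval]
    change z t = F ((q t).1, sc • ConicalDiscTube.kap (ofC (((β t).2 : ℂ) * u₀)))
    rw [hfibre_back, Prod.mk.eta, hFq]
  -- every loop of `B(0,R) × (ℂ ∖ 0)` is a power of the slice winding loop
  obtain ⟨n, hn⟩ := Subgroup.mem_zpowers_iff.1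
    (fromPath_mem_zpowers_slice (⟨x₀, mem_ball_zero_iff.2 hx₀R⟩ : ↥(ball (0 : EuclideanSpace ℝ (Fin 2)) R)) r₀ hr₀pos β)
  have e1 := FundamentalGroup.mapOfEq_fromPath_eq Φ hb β γ hγβ
  -- the meridian through `p`
  have hmer : ∀ t : I, ((Φ (sliceWindingLoop (⟨x₀, mem_ball_zero_iff.2 hx₀R⟩ : ↥(ball (0 : EuclideanSpace ℝ (Fin 2)) R)) r₀ hr₀pos t) : ↥Z) : EuclideanSpace ℝ (Fin 4)) =
      F (x₀, ofC (Complex.exp (((2 * Real.pi * t : ℝ) : ℂ) * Complex.I) * toC w₀)) := fun t => by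
    rw [hΦval, sliceWindingLoop_apply]
    change F (x₀, sc • ConicalDiscTube.kap (ofC ((windingLoop r₀ hr₀pos 1 t : ℂ) * u₀))) = _
    congr 2
    rw [windingLoop_apply_coe, Int.cast_one, mul_one]
    have he : ‖Complex.exp (((2 * Real.pi * t : ℝ) : ℂ) * Complex.I)‖ = 1 := by rw [Complex.norm_exp_ofReal_mul_I]
    rw [show ((r₀ : ℂ) * Complex.exp (((2 * Real.pi * t : ℝ) : ℂ) * Complex.I)) * u₀ =
        Complex.exp (((2 * Real.pi * t : ℝ) : ℂ) * Complex.I) * ((r₀ : ℂ) * u₀) by ring, kap_ofC_mul he, ← ofC_smul]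
    congr 1
    rw [← mul_assoc, mul_comm (sc : ℂ), mul_assoc]
    congr 1
    rw [← toC_smul, hψv₀]
  refine ⟨n, fun μ hμ => ?_, fun hn0 => ?_⟩
  · -- the Hurewicz class
    have e2 := FundamentalGroup.mapOfEq_fromPath_eq Φ hb
      (sliceWindingLoop (⟨x₀, mem_ball_zero_iff.2 hx₀R⟩ : ↥(ball (0 : EuclideanSpace ℝ (Fin 2)) R)) r₀ hr₀pos) μ
      (fun t => Subtype.ext (by rw [hμ t, hmer t]))
    have key : FundamentalGroup.fromPath (Path.Homotopic.Quotient.mk γ) =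
        FundamentalGroup.fromPath (Path.Homotopic.Quotient.mk μ) ^ n := by
      rw [← e1, ← hn, map_zpow, e2]
    have := congrArg (fun g => Multiplicative.toAdd (hurewiczOneAb ℤ ℤ (1 : ℤ) p (Abelianization.of g))) key
    simpa only [map_zpow, hurewiczOneAb_of_fromPath, toAdd_zpow, toAdd_ofAdd] using this
  · -- exponent zero: `β` is null-homotopic, and so is the fibre coordinate
    subst hn0
    have hβ1 : Path.Homotopic.Quotient.mk β = Path.Homotopic.Quotient.mk (Path.refl b) := by
      have : FundamentalGroup.fromPath (Path.Homotopic.Quotient.mk β) = 1 := by rw [← hn, zpow_zero]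
      rw [FundamentalGroup.one_def] at this
      exact this
    obtain ⟨Hβ⟩ := Path.Homotopic.Quotient.eq.1 hβ1
    refine ⟨fun st => sc • ConicalDiscTube.kap (ofC (((Hβ st).2 : ℂ) * u₀)), ?_, fun st => (hψmem (Hβ st).2).2,
      fun t => ?_, fun t => ?_, fun s => ⟨?_, ?_⟩⟩
    · have h2 : Continuous fun st : I × I => ((Hβ st).2 : ℂ) * u₀ :=
        (continuous_subtype_val.comp (continuous_snd.comp Hβ.continuous)).mul continuous_const
      exact (ConicalDiscTube.continuous_kap.comp (continuous_ofC.comp h2)).const_smul sc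
    · have : Hβ (0, t) = β t := Hβ.apply_zero t
      dsimp only
      rw [this, hfibre_back]
    · have : Hβ (1, t) = b := Hβ.apply_one t
      dsimp only
      rw [this]; exact hψv₀
    · have : Hβ (s, 0) = b := Hβ.source s
      dsimp only
      rw [this]; exact hψv₀
    · have : Hβ (s, 1) = b := Hβ.target s
      dsimp only
      rw [this]; exact hψv₀

end FriendsCarrierVk

open FriendsCarrierVk in
/-- **Helper `helper_friendsCarrier_Vk_partA_tubeLoops`** (piece of `helper_friendsCarrier_Vk_partA`: loops in a
punctured tube).  Let `F : ℝ² × ℝ² → ℝ⁴` be continuous on `B(0,R) × B(0,η)` with a left inverse `Finv`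
continuous on the image, and `Z ⊆ ℝ⁴` a subspace containing the punctured tube `F(B(0,R) × (B(0,η) ∖ 0))`.
For a loop `γ` of `Z` at `p = F(x₀, w₀)` running in the punctured tube there is `n : ℤ` with: the Hurewicz
class of `γ` in `H₁(Z; ℤ)` is `n` times that of the meridian `t ↦ F(x₀, e^{2πit} w₀)` through `p`, and if
`n = 0` the fibre-coordinate loop `t ↦ (Finv (γ t)).2` is null-homotopic in `ℝ² ∖ 0` rel base point.
[cite: HatcherAT2002, Thm. 1.7] -/
theorem helper_friendsCarrier_Vk_partA_tubeLoops : ∀ (F : EuclideanSpace ℝ (Fin 2) × EuclideanSpace ℝ (Fin 2) → EuclideanSpace ℝ (Fin 4)) (Finv : EuclideanSpace ℝ (Fin 4) → EuclideanSpace ℝ (Fin 2) × EuclideanSpace ℝ (Fin 2)) (R η : ℝ), 0 < η → ContinuousOn F (Metric.ball (0 : EuclideanSpace ℝ (Fin 2)) R ×ˢ Metric.ball (0 : EuclideanSpace ℝ (Fin 2)) η) → ContinuousOn Finv (F '' (Metric.ball (0 : EuclideanSpace ℝ (Fin 2)) R ×ˢ Metric.ball (0 : EuclideanSpace ℝ (Fin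 2)) η)) → (∀ q ∈ Metric.ball (0 : EuclideanSpace ℝ (Fin 2)) R ×ˢ Metric.ball (0 : EuclideanSpace ℝ (Fin 2)) η, Finv (F q) = q) → ∀ (Z : Set (EuclideanSpace ℝ (Fin 4))), F '' (Metric.ball (0 : EuclideanSpace ℝ (Fin 2)) R ×ˢ (Metric.ball (0 : EuclideanSpace ℝ (Fin 2)) η ∩ {w | w ≠ 0})) ⊆ Z → ∀ (p : ↥Z) (γ : Path p p), (∀ t, ((γ t : ↥Z) : EuclideanSpace ℝ (Fin 4)) ∈ F '' (Metric.ball (0 : EuclideanSpace ℝ (Fin 2)) R ×ˢ (Metric.ball (0 : EuclideanSpace ℝ (Fin 2)) η ∩ {w | w ≠ 0}))) → ∃ n : ℤ, (∀ μ : Path p p, (∀ t, ((μ t : ↥Z) : EuclideanSpace ℝ (Fin 4)) = F ((Finv (p : EuclideanSpace ℝ (Fin 4))).1, Literature.Topology.FourManifolds.PlaneComplex.ofC (Complex.exp (((2 * Real.pi * t : ℝ) : ℂ) * Complex.I) * Literature.Topology.FourManifolds.toC (Finv (p : EuclideanSpace ℝ (Fin 4))).2))) → Literature.AlgebraicTopology.SingularHomology.loopClass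 ℤ ℤ (1 : ℤ) γ = n • Literature.AlgebraicTopology.SingularHomology.loopClass ℤ ℤ (1 : ℤ) μ) ∧ (n = 0 → ∃ h : unitInterval × unitInterval → EuclideanSpace ℝ (Fin 2), Continuous h ∧ (∀ q, h q ≠ 0) ∧ (∀ t, h (0, t) = (Finv ((γ t : ↥Z) : EuclideanSpace ℝ (Fin 4))).2) ∧ (∀ t, h (1, t) = (Finv (p : EuclideanSpace ℝ (Fin 4))).2) ∧ ∀ s, h (s, 0) = (Finv (p : EuclideanSpace ℝ (Fin 4))).2 ∧ h (s, 1) = (Finv (p : EuclideanSpace ℝ (Fin 4))).2) := by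
  intro F Finv R η hη hFc hFinvc hleft Z hZ p γ hγ
  exact exists_meridian_exponent F Finv R η hη hFc hFinvc hleft Z hZ γ hγ

end Summit.SmoothPoincare4.SmoothPoincare4.Theorems.DcrGap.MkFriends

end
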